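import Literature.NumberTheory.Automorphic.Liu2021.Def411WeilCarriers
import Literature.NumberTheory.NumberFields.FiniteIdeleCongruenceSubgroupBasis
import Literature.NumberTheory.Automorphic.UnitaryGroupAdelicContinuity
import Literature.GroupTheory.PiCharacterFactorsFinitely
import HarnessLib

/-!
# [Liu2021, Def. 4.11]: automorphic characters of `E¹\(𝔸_E^∞)¹` are smooth, and their Galois twists `σ ∘ χ` are again automorphic

Topic `NumberTheory/Automorphic/Liu2021`; namespaces `Literature.NumberTheory.Automorphic.UnitaryGroup` (§1, the norm-one finite-idèle
torus `finAdelicOne F E c = U(1)(𝔸_{F,f})`) and `Literature.NumberTheory.Automorphic.Liu2021.Def411WeilCarriers` (§2, the index type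
`Chi F E c` of [Liu2021, Def. 4.11 / Thm. 4.18]).  THEOREMS ONLY (no definition, no named fact, no instance).

[Liu2021, Def. 4.11, third bullet (FJcycle.tex l. 2090)]: «an automorphic character `χ = ⊗ χ_v : E¹\(𝔸_E^∞)¹ → ℂ^×`» — in the tree
`IsAutomorphicOneChar F E c χ` = CONTINUOUS + trivial on `E¹`.  In the proof of Thm. 4.18 (3) (l. 2272–2289) the summand `ω(μ,ε,χ)` is
twisted by `σ ∈ Aut(ℂ/M_μ)`, an ABSTRACT field automorphism (no continuity), and the character of the twist is `σ ∘ χ`; that this is again an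
admissible index needs «`σ ∘ χ` is automorphic», i.e. CONTINUOUS — true because `χ` is SMOOTH:

* §1 `UnitaryGroup.isOpen_ker_of_continuous` — a continuous `χ : U(1)(𝔸_{F,f}) →* ℂˣ` has OPEN KERNEL: `ℂˣ` has no small subgroups
  (tree `PiCharacter.isNSSNhd_units_complex`) and every neighbourhood of `1` in the finite idèle group contains a congruence subgroup `I^𝔪_f`
  (tree `IdeleAction.exists_congruenceUnits_subset_of_mem_nhds`, [NeukirchANT1999, VI (1.8)]), whose trace on `U(1)(𝔸_{F,f})` is an open
  subgroup killed by `χ` ([BernsteinZelevinsky1976, §2.1]: characters of totally disconnected groups are smooth);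
  `UnitaryGroup.continuous_unitsMap_comp` — hence `τ ∘ χ` is continuous for EVERY monoid endomorphism `τ` of `ℂ` (e.g. `σ ∈ Aut(ℂ)`).
* §2 `Def411WeilCarriers.isAutomorphicOneChar_unitsMap_comp` (`…_chi`, `…_ringEquiv_comp_chi`) — for `χ ∈ Chi F E c` and any `τ : ℂ →* ℂ`, `(Units.map τ) ∘ χ` is automorphic
  (P5b′ of the cell hodgecm-mathlib's road to row III-11, A-p19's seam ruling 2026-08-28T06:50:51Z); the `RingEquiv`/`RingHom` readings.

HC_CM is proved only modulo the 7 printed citations until rung 0 closes; this file discharges none of them.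

## References
* [Liu2021] Y. Liu, Camb. J. Math. 9 (2021) = arXiv:2102.11518, Def. 4.11 (l. 2090); Thm. 4.18 (3) proof (l. 2272–2289).
* [BernsteinZelevinsky1976] I. N. Bernstein, A. V. Zelevinsky, Russian Math. Surveys 31 (1976), §2.1 (smooth characters).
* [NeukirchANT1999] J. Neukirch, *Algebraic Number Theory* (1999), Ch. VI §1 Prop. (1.8) (congruence subgroups are a basis).
-/

noncomputable section

open NumberField IsDedekindDomain
open _root_.Topology _root_.Filter

/-! ## §1 Continuous characters of `U(1)(𝔸_{F,f})` are smooth -/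

namespace Literature.NumberTheory.Automorphic.UnitaryGroup

variable {F E : Type} [Field F] [Field E] [NumberField E] [Algebra F E] (c : E ≃ₐ[F] E)

/-- **A continuous character `χ : U(1)(𝔸_{F,f}) →* ℂˣ` has open kernel** (is smooth): pull the no-small-subgroups neighbourhood of `1 ∈ ℂˣ`
back to `U(1)(𝔸_{F,f}) ≤ (𝔸_{E,f})ˣ`, find a congruence subgroup `I^𝔪_f` inside, and note that `χ(I^𝔪_f ∩ U(1))` is a subgroup of `ℂˣ` inside
that neighbourhood, hence trivial. [cite: BernsteinZelevinsky1976, §2.1] [cite: NeukirchANT1999, Ch. VI §1 Prop. (1.8) (proof) p. 364] -/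
theorem isOpen_ker_of_continuous (χ : finAdelicOne F E c →* ℂˣ) (hχ : Continuous χ) :
    IsOpen (χ.ker : Set (finAdelicOne F E c)) := by
  classical
  obtain ⟨hU₀, hNSS⟩ := Literature.GroupTheory.PiCharacter.isNSSNhd_units_complex
  set U₀ : Set ℂˣ := {u : ℂˣ | ‖(u : ℂ) - 1‖ < 2⁻¹} with hU₀def
  -- `χ ⁻¹ U₀` is a neighbourhood of `1` in the subspace `U(1)(𝔸_{F,f})` of the finite idèle group
  have h1 : χ ⁻¹' U₀ ∈ 𝓝 (1 : finAdelicOne F E c) :=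
    hχ.continuousAt.preimage_mem_nhds (by rw [map_one]; exact hU₀)
  rw [nhds_subtype, Filter.mem_comap] at h1
  obtain ⟨V, hV, hVU⟩ := h1
  -- a congruence subgroup inside `V`
  obtain ⟨𝔪, -, h𝔪V⟩ :=
    Literature.NumberTheory.NumberFields.IdeleAction.exists_congruenceUnits_subset_of_mem_nhds (R := 𝓞 E) (K := E) hV
  -- its trace on `U(1)(𝔸_{F,f})`
  set H : Subgroup (finAdelicOne F E c) :=
    (Literature.NumberTheory.NumberFields.IdeleAction.congruenceUnits (K := E) 𝔪).comap (finAdelicOne F E c).subtype with hH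
  have hHopen : IsOpen (H : Set (finAdelicOne F E c)) :=
    (Literature.NumberTheory.NumberFields.IdeleAction.isOpen_congruenceUnits (K := E) 𝔪).preimage continuous_subtype_val
  -- `χ(H)` is a subgroup of `ℂˣ` inside `U₀`, hence trivial
  have hmap : (H.map χ : Set ℂˣ) ⊆ U₀ := by
    rintro _ ⟨k, hk, rfl⟩
    exact hVU (h𝔪V hk)
  have hbot : H.map χ = ⊥ := hNSS _ hmap
  have hle : H ≤ χ.ker := fun k hk => by
    rw [MonoidHom.mem_ker]
    have : χ k ∈ H.map χ := ⟨k, hk, rfl⟩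
    rw [hbot] at this
    exact Subgroup.mem_bot.1 this
  exact Subgroup.isOpen_mono hle hHopen

/-- **Hence `τ ∘ χ` is continuous for every monoid endomorphism `τ : ℂ →* ℂ`** (in particular for an abstract field automorphism
`σ ∈ Aut(ℂ)`, which is NOT continuous on `ℂ`): `τ ∘ χ` kills the open kernel of `χ`. [cite: BernsteinZelevinsky1976, §2.1] -/
theorem continuous_unitsMap_comp (χ : finAdelicOne F E c →* ℂˣ) (hχ : Continuous χ) (τ : ℂ →* ℂ) :
    Continuous ((Units.map τ).comp χ) :=
  continuous_of_isOpen_of_forall_map_eq_one ((Units.map τ).comp χ) χ.ker (isOpen_ker_of_continuous c χ hχ) fun k hk => by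
    rw [MonoidHom.comp_apply, (MonoidHom.mem_ker).1 hk, map_one]

/-- The `ℂ`-valued reading: `u ↦ τ (χ u)` is continuous. [cite: BernsteinZelevinsky1976, §2.1] -/
theorem continuous_apply_coe_comp (χ : finAdelicOne F E c →* ℂˣ) (hχ : Continuous χ) (τ : ℂ →* ℂ) :
    Continuous fun u => τ ((χ u : ℂˣ) : ℂ) := by
  have h := Units.continuous_val.comp (continuous_unitsMap_comp c χ hχ τ)
  exact h.congr fun u => by simp [Units.coe_map]

end Literature.NumberTheory.Automorphic.UnitaryGroup

/-! ## §2 Galois twists of the characters `χ ∈ Chi` of [Liu2021, Def. 4.11] -/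

namespace Literature.NumberTheory.Automorphic.Liu2021.Def411WeilCarriers

variable {F E : Type} [Field F] [Field E] [NumberField E] [Algebra F E] (c : E ≃ₐ[F] E)

/-- **`τ ∘ χ` is automorphic** for every automorphic character `χ` of `E¹\(𝔸_E^∞)¹` and every monoid endomorphism `τ : ℂ →* ℂ`: continuity by
smoothness of `χ` (§1), triviality on `E¹` since `τ 1 = 1`.  (P5b′ of the III-11 road: for `σ ∈ Aut(ℂ/M_μ)` the index `(ε, σ∘χ)` is again an index of
[Liu2021, Thm. 4.18].) [cite: Liu2021, Def. 4.11 (FJcycle.tex l. 2090); Thm. 4.18 (3) proof (l. 2272–2289)] -/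
theorem isAutomorphicOneChar_unitsMap_comp {χ : UnitaryGroup.finAdelicOne F E c →* ℂˣ} (hχ : IsAutomorphicOneChar F E c χ)
    (τ : ℂ →* ℂ) : IsAutomorphicOneChar F E c ((Units.map τ).comp χ) :=
  ⟨UnitaryGroup.continuous_unitsMap_comp c χ hχ.1 τ, fun x hx => by
    rw [MonoidHom.comp_apply, hχ.2 x hx, map_one]⟩

/-- The same for an element of the index type `Chi F E c`. [cite: Liu2021, Def. 4.11 (FJcycle.tex l. 2090)] -/
theorem isAutomorphicOneChar_unitsMap_comp_chi (χ : Chi F E c) (τ : ℂ →* ℂ) :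
    IsAutomorphicOneChar F E c ((Units.map τ).comp χ.1) :=
  isAutomorphicOneChar_unitsMap_comp c χ.2 τ

/-- Reading for a ring automorphism `σ : ℂ ≃+* ℂ` (the `σ ∈ Aut(ℂ/M_μ)` of [Liu2021, Thm. 4.18 (3)]): `(Units.map ↑σ) ∘ χ` is automorphic.
[cite: Liu2021, Def. 4.11 (FJcycle.tex l. 2090); Thm. 4.18 (3) proof (l. 2272–2289)] -/
theorem isAutomorphicOneChar_unitsMap_ringEquiv_comp_chi (χ : Chi F E c) (σ : ℂ ≃+* ℂ) :
    IsAutomorphicOneChar F E c ((Units.map (σ : ℂ →* ℂ)).comp χ.1) :=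
  isAutomorphicOneChar_unitsMap_comp c χ.2 (σ : ℂ →* ℂ)

/-- … and the values of the twisted character: `((Units.map ↑σ) ∘ χ) u = σ (χ u)` in `ℂ`. [cite: Liu2021, Thm. 4.18 (3) proof (l. 2272–2289)] -/
theorem coe_unitsMap_ringEquiv_comp_chi_apply (χ : Chi F E c) (σ : ℂ ≃+* ℂ) (u : UnitaryGroup.finAdelicOne F E c) :
    ((((Units.map (σ : ℂ →* ℂ)).comp χ.1) u : ℂˣ) : ℂ) = σ ((χ.1 u : ℂˣ) : ℂ) := by
  simp [Units.coe_map]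

/-- Every automorphic `χ` is SMOOTH (open kernel) — recorded for the index type. [cite: Liu2021, Def. 4.11 (FJcycle.tex l. 2090)] [cite: BernsteinZelevinsky1976, §2.1] -/
theorem isOpen_ker_chi (χ : Chi F E c) : IsOpen (χ.1.ker : Set (UnitaryGroup.finAdelicOne F E c)) :=
  UnitaryGroup.isOpen_ker_of_continuous c χ.1 χ.2.1

end Literature.NumberTheory.Automorphic.Liu2021.Def411WeilCarriers

end
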